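import Literature.NumberTheory.LFunctions.ThetaChainCheck
import HarnessLib

/-!
# Rosser–Schoenfeld 1962, (3.21) on a finite range by kernel computation: the checker

Literature/NumberTheory/LFunctions. J. B. Rosser, L. Schoenfeld, *Approximate formulas for some
functions of prime numbers*, Illinois J. Math. 6 (1962), 64–94, Theorem 6, (3.21):
`log x + E − 1/(2 log x) < Σ_{p ≤ x} (log p)/p` for `x > 1`, `E = −γ − Σ_p (log p)/(p(p−1))`
(the named fact `RosserSchoenfeld1962_eq_3_21` of `RosserSchoenfeldMertensFirst.lean`). Rosser and
Schoenfeld settle the range `x ≤ 16 000` by the Rosser–Walker tabulation and `x ≤ 10⁸` by the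
Appel–Rosser tabulation (their Thm. 21; pp. 76, 87), the analytic argument taking over at `10⁸`.
This file is the *computable core* of a kernel certificate for such a tabulated range, walking the
complete prime table `ChainTable.table` (the `322 441` primes below `4.6·10⁶`, `ChainTableFacts`)
exactly as the `θ`-chain of `ThetaChainCheck.lean` does for Schoenfeld's bound; the semantic
soundness is `RosserSchoenfeldMertensChainSound.lean`, the run `RosserSchoenfeldMertensChainRun*.lean`.

## The state and one step

A state `⟨p, Llo, Lhi, Slo, Plo⟩` records the last prime `p` reached, natural-number enclosures
`Llo ≤ 2⁸⁰ log p ≤ Lhi`, and lower bounds `Slo ≤ 2⁸⁰ S(p)`, `Plo ≤ 2⁸⁰ P(p)` of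
`S(p) = Σ_{q ≤ p} (log q)/q` and `P(p) = Σ_{q ≤ p} (log q)/(q(q−1))` (so that
`E ≤ −γ − P(p) ≤ −(GAMMALO + Plo)/2⁸⁰`, `ChainCheck.GAMMALO ≤ 2⁸⁰γ`). A step to the next table entry
`p'` (`step`) checks `p < p'`, `p'` odd and prime (`ThetaChain.primeChk`), extends the enclosure of the
logarithm (`ThetaChain.logNext`), performs the comparison behind (3.21) on `[p, p')` — since
`x ↦ log x + E − 1/(2 log x)` increases and `S` is constant there, it is
`log p' + E − 1/(2 log p') ≤ S(p)`, tested as `2L'² ≤ 2·Slo·L' + 2·(GAMMALO + Plo)·L' + 2¹⁶⁰` with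
`L' = Lhi(p')` (`chk321`) — and updates `Slo += ⌊Llo'/p'⌋`, `Plo += ⌊Llo'/(p'(p'−1))⌋`. `run` iterates
with fuel over a segment of the table (chunks of `20000`; `runD` restarts from the table cursor
after `p`), from `initS = ⟨2, log 2, S(2) = P(2) = (log 2)/2⟩`.

All arithmetic is on `ℕ` with the kernel's GMP-accelerated primitives, as in `ChainCheck.lean` and
`ThetaChainCheck.lean`, whose primality test and logarithms are reused. **Proved here**: the
arithmetic soundness of the comparison (`chk321_sound`) and of the two accumulations
(`natDiv_le_real`). Nothing is asserted: the `def`s are the computable functions and one constant.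

## References
* J. B. Rosser, L. Schoenfeld, Illinois J. Math. 6 (1962), 64–94, Thm. 6 (3.21) and pp. 76, 87
  (the tabulated ranges of the proof of Thm. 6). [RosserSchoenfeld1962]
-/

namespace Literature.NumberTheory.LFunctions.MertensChain

open ChainCheck ChainTable ThetaChain

/-! ### The comparison behind (3.21) on one interval, in naturals -/

/-- `2¹⁶⁰` as a numeral (same value as `ThetaChain.P160`). [folklore] -/
def Q160 : ℕ := 1461501637330902918203684832716283019655932542976

/-- `chk321 Slo EP L`: the test `2·L·L ≤ 2·Slo·L + 2·EP·L + 2¹⁶⁰`; with `L ≥ 2⁸⁰ log p' > 0`,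
`Slo ≤ 2⁸⁰ S`, `EP ≤ 2⁸⁰ (−E)` it implies `log p' + E − 1/(2 log p') ≤ S` (`chk321_sound`).
[cite: RosserSchoenfeld1962, Thm. 6 (3.21)] -/
def chk321 (Slo EP L : ℕ) : Bool :=
  Nat.ble (Nat.mul (Nat.mul 2 L) L)
    (Nat.add (Nat.add (Nat.mul (Nat.mul 2 Slo) L) (Nat.mul (Nat.mul 2 EP) L)) Q160)

/-! ### States, one step, the run -/

/-- A state of the (3.21)-chain: the prime `p` reached, `Llo ≤ 2⁸⁰ log p ≤ Lhi`,
`Slo ≤ 2⁸⁰ Σ_{q ≤ p} (log q)/q`, `Plo ≤ 2⁸⁰ Σ_{q ≤ p} (log q)/(q(q−1))`. [folklore] -/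
structure MS where
  /-- the last prime reached -/
  p : ℕ
  /-- lower bound of `2⁸⁰ log p` -/
  Llo : ℕ
  /-- upper bound of `2⁸⁰ log p` -/
  Lhi : ℕ
  /-- lower bound of `2⁸⁰ Σ_{q ≤ p} (log q)/q` -/
  Slo : ℕ
  /-- lower bound of `2⁸⁰ Σ_{q ≤ p} (log q)/(q(q−1))` -/
  Plo : ℕ
  deriving Repr, DecidableEq

/-- **One step** of the (3.21)-chain, to the next table entry `p'`: order, parity and primality of
`p'`; the new enclosure of `log p'`; the comparison for the interval `[p, p')`; the two accumulations.
[cite: RosserSchoenfeld1962, Thm. 6 (3.21)] -/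
def step (s : MS) (p' : ℕ) : Option MS :=
  match s with
  | ⟨p, Llo, Lhi, Slo, Plo⟩ =>
    bif !(Nat.blt p p' && Nat.beq (Nat.mod p' 2) 1 && primeChk p') then none else
    match logNext p Llo Lhi p' with
    | none => none
    | some (Llo', Lhi') =>
      bif !(chk321 Slo (Nat.add GAMMALO Plo) Lhi') then none else
      some ⟨p', Llo', Lhi', Nat.add Slo (Nat.div Llo' p'),
        Nat.add Plo (Nat.div Llo' (Nat.mul p' (Nat.sub p' 1)))⟩

/-- Run over a segment of the table with fuel (a chunk): stops successfully when the fuel or the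
segment is exhausted, fails as soon as a step fails. [folklore] -/
def run : ℕ → MS → List ℕ → Option MS
  | 0, s, _ => some s
  | _ + 1, s, [] => some s
  | fuel + 1, s, p' :: rest =>
    match step s p' with
    | none => none
    | some s' => run fuel s' rest

/-- The initial state: `p = 2`, `log 2`, `S(2) = P(2) = (log 2)/2`
(`ChainCheck.L2LON ≤ 2⁸⁰ log 2 ≤ ChainCheck.L2HIN`). [folklore] -/
def initS : MS := ⟨2, L2LON, L2HIN, Nat.div L2LON 2, Nat.div L2LON 2⟩

/-- **A chunk of the run**: at most `fuel` entries of `ChainTable.table` after the state's prime.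
[folklore] -/
def runD (fuel : ℕ) (s : MS) : Option MS := run fuel s (ChainCheck.after s.p table)

/-! ## Soundness of the arithmetic -/

section Sound

/-- `Q160 = 2¹⁶⁰`. [folklore] -/
theorem Q160_eq : Q160 = 2 ^ 160 := by norm_num [Q160]

/-- `⌊a/b⌋ ≤ a/b` over `ℝ` (for the accumulations `Slo += ⌊Llo'/p'⌋`, `Plo += ⌊Llo'/(p'(p'−1))⌋`).
[folklore] -/
theorem natDiv_le_real (a b : ℕ) : ((Nat.div a b : ℕ) : ℝ) ≤ (a : ℝ) / b := by
  rw [natdiv_eq]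
  exact Nat.cast_div_le

/-- **Soundness of `chk321`**: if `chk321 Slo EP L` holds, `2⁸⁰ log y ≤ L`, `0 < log y`,
`Slo ≤ 2⁸⁰ S`, `EP ≤ 2⁸⁰ (−E)`, then `log y + E − 1/(2 log y) ≤ S`.
[cite: RosserSchoenfeld1962, Thm. 6 (3.21)] -/
theorem chk321_sound {Slo EP L : ℕ} (h : chk321 Slo EP L = true) {y S E : ℝ}
    (hlog : 0 < Real.log y) (hL : 2 ^ 80 * Real.log y ≤ L) (hS : (Slo : ℝ) ≤ 2 ^ 80 * S)
    (hE : (EP : ℝ) ≤ 2 ^ 80 * (-E)) :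
    Real.log y + E - 1 / (2 * Real.log y) ≤ S := by
  have hble : 2 * L * L ≤ 2 * Slo * L + 2 * EP * L + Q160 := by
    simpa [chk321, Nat.ble_eq, Nat.mul_eq, Nat.add_eq] using h
  rw [Q160_eq] at hble
  have hR : 2 * (L : ℝ) * L ≤ 2 * (Slo : ℝ) * L + 2 * (EP : ℝ) * L + 2 ^ 160 := by
    exact_mod_cast hble
  have hL0 : (0 : ℝ) < L := lt_of_lt_of_le (by positivity) hL
  -- divide by `2L`: `L ≤ Slo + EP + 2¹⁶⁰/(2L)`
  have h1 : (L : ℝ) ≤ Slo + EP + 2 ^ 160 / (2 * L) := by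
    have : (L : ℝ) - Slo - EP ≤ 2 ^ 160 / (2 * L) := by
      rw [le_div_iff₀ (by positivity)]
      nlinarith
    linarith
  -- `2¹⁶⁰/(2L) ≤ 2⁸⁰ · 1/(2 log y)` since `2⁸⁰ log y ≤ L`
  have h2 : (2 : ℝ) ^ 160 / (2 * L) ≤ 2 ^ 80 * (1 / (2 * Real.log y)) := by
    rw [div_le_iff₀ (by positivity)]
    have e : (2 : ℝ) ^ 80 * (1 / (2 * Real.log y)) * (2 * L) = 2 ^ 80 * L / Real.log y := by
      field_simp
    rw [e, le_div_iff₀ hlog]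
    nlinarith
  have key : 2 ^ 80 * (Real.log y + E - 1 / (2 * Real.log y)) ≤ 2 ^ 80 * S := by
    linarith
  exact le_of_mul_le_mul_left key (by positivity)

end Sound

end Literature.NumberTheory.LFunctions.MertensChain
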